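import Summits.NavierStokesRegularity.FunctionalMining.PalinstrophyLogDoor
import HarnessLib

/-!
# FunctionalMining — the large-`C` log door on `T³` is a theorem (dict seat, staged v7)

Search for candidate a priori estimates; no regularity claim.

STAGED FILE (planner/dict seat cannot file under `FunctionalMining/`; the prove seat files it).
This module is the second half of the dict seat's log door: it must be filed AFTER
`PalinstrophyLogDoor.lean` (= `pub-nsfunc-dict/LogDoor.lean` v6, 398 lines) and imports it under
the tree name above — adjust the import if the prove seat files the door under another name.
The COMBINED text (door v6 + this section) was checked on the farm as ONE file
(`pub-nsfunc-dict/LogDoorFull.lean`, 650 lines: rc 0, 0 errors, 0 warnings, 0 sorry;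
`#print axioms palinstrophyLogBudgetLargeC_fin3_holds` = propext, Classical.choice, Quot.sound).

## Content

* `dgImpliesLogBudget_holds : DGImpliesLogBudget` — the M-sized prove target of door v3–v6,
  PROVED: (a‴) `PalinstrophyLogBudgetDG C₁ c₁` ⇒ (a) `PalinstrophyLogBudget C c` for every `c > 0`
  and every `C ≥ C₁·(5/3 + ⅙log⁺(c₁⁶) + ⅔log⁺(c⁻¹))`. Mechanism: a positive rate `R > 0` forces
  `νD₃ < N ≤ 3G𝒫` (balance + production bound) with the Agmon majorant `G² = (2/π²)√𝒫√D₃`, so the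
  ADMISSIBLE vorticity bound `M₁ = √2·G` (pointwise `|ω|² ≤ 2|∇u|²`) satisfies `M₁⁶ν² ≤ 𝒫⁴`
  (`1152 ≤ π⁸`); (a‴) is applied at `min M M₁` and `log⁺(c₁M₁/ν) ≤ A₀ + ⅔log(e + c𝒫/ν²)`.
* `palinstrophyLogBudgetLargeC_fin3_holds : PalinstrophyLogBudgetLargeC (d := Fin 3)` — for every
  `c > 0` some `C` makes K1-Q3(a) `Ṗ ≤ C‖ω‖_∞𝒫 log(e + c𝒫/ν²)` a TRUE a priori inequality for
  classical solutions on `T³` (ingredients: Literature theorem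
  `Torus.exists_gradSq_le_sq_bkm_posLog_ratio` [DG95 Thm 7.5 shape, p201667], `bkmImpliesDG_holds`,
  `dgImpliesLogBudget_holds`). Together with the no-go seat's paper-level threshold (`false for
  C < 2/π`, THRESHOLD.md) this settles K1-Q3 as a THRESHOLD LAW up to the window `[2/π, C⋆(c))`.
  It is a differential inequality driven by `‖ω‖_∞` — the BKM quantity — and says NOTHING about
  regularity (BKM-type criteria are exactly what it re-expresses).
* `palinstrophyLogBudgetLargeC_of_BKM'` — generic index type: the BKM shape alone gives the door.
* helpers `posLog_mono`, `posLog_mul_le`, `posLog_pow` (the fact `1 ≤ log(e + y)` is inlined; a named copy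
  lives in `Literature.Barriers.NavierStokesRegularity.InstantaneousTypeIBlowupDecomposition`),
  `posLog_le_log_exp_one_add` (elementary `log⁺` bookkeeping).
-/

noncomputable section

open Set MeasureTheory
open scoped InnerProductSpace RealInnerProductSpace

namespace Summit.NavierStokesRegularity.FunctionalMining

open Literature.Analysis.FunctionSpaces Literature.Analysis.FluidPDE

variable {d : Type*} [Fintype d] [DecidableEq d]

/-! ## v7: `DGImpliesLogBudget` PROVED — the large-`C` log door is a THEOREM on `T³`

(a‴) ⇒ (a) for all large `C`, by real analysis on tree material: for a state with positive rate
`R > 0` the balance gives `νD₃ < N ≤ 3G𝒫` with the Agmon majorant `G² = (2/π²)√𝒫√D₃`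
(`gradientAgmonBound_holds`, `palinstrophyProductionSupBound_holds`), whence the ADMISSIBLE
vorticity bound `M₁ := √2·G` (`torusVorticitySqAt_le_two_mul_sum_norm_sq`) obeys
`M₁⁶ν² ≤ (1152/π⁸)𝒫⁴ ≤ 𝒫⁴`; (a‴) at `min M M₁` and `log⁺` bookkeeping give
`R ≤ C₁(5/3 + A₀)·M·𝒫·log(e + c𝒫/ν²)`, `A₀ = ⅙log⁺(c₁⁶) + ⅔log⁺(1/c)`.
Search for candidate a priori estimates; no regularity claim. -/

section LargeC

/-- `log⁺` is monotone on `[0, ∞)`. [elementary] -/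
theorem posLog_mono {a b : ℝ} (ha : 0 ≤ a) (hab : a ≤ b) :
    max 0 (Real.log a) ≤ max 0 (Real.log b) := by
  rcases ha.eq_or_lt with h0 | hpos
  · rw [← h0, Real.log_zero, max_self]; exact le_max_left _ _
  · exact max_le_max le_rfl (Real.log_le_log hpos hab)

/-- `log⁺(ab) ≤ log⁺ a + log⁺ b` for `a, b ≥ 0`. [elementary] -/
theorem posLog_mul_le {a b : ℝ} (ha : 0 ≤ a) (hb : 0 ≤ b) :
    max 0 (Real.log (a * b)) ≤ max 0 (Real.log a) + max 0 (Real.log b) := by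
  have h0 : 0 ≤ max 0 (Real.log a) + max 0 (Real.log b) :=
    add_nonneg (le_max_left _ _) (le_max_left _ _)
  rcases ha.eq_or_lt with ha0 | hapos
  · rw [← ha0, zero_mul, Real.log_zero, max_self]; positivity
  rcases hb.eq_or_lt with hb0 | hbpos
  · rw [← hb0, mul_zero, Real.log_zero, max_self]; positivity
  refine max_le h0 ?_
  rw [Real.log_mul hapos.ne' hbpos.ne']
  exact add_le_add (le_max_right _ _) (le_max_right _ _)

/-- `log⁺(yⁿ) = n·log⁺ y`. [elementary] -/
theorem posLog_pow (y : ℝ) (n : ℕ) : max 0 (Real.log (y ^ n)) = n * max 0 (Real.log y) := by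
  rw [Real.log_pow]
  have hn : (0 : ℝ) ≤ n := Nat.cast_nonneg n
  rcases le_or_gt (Real.log y) 0 with h | h
  · have : (n : ℝ) * Real.log y ≤ 0 := by nlinarith
    rw [max_eq_left h, max_eq_left this, mul_zero]
  · rw [max_eq_right h.le, max_eq_right (mul_nonneg hn h.le)]

/-- `log⁺ y ≤ log(e + y)` for `y ≥ 0`. [elementary] -/
theorem posLog_le_log_exp_one_add {y : ℝ} (hy : 0 ≤ y) :
    max 0 (Real.log y) ≤ Real.log (Real.exp 1 + y) := by
  have h1 : 1 ≤ Real.log (Real.exp 1 + y) := by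
    rw [Real.le_log_iff_exp_le (by positivity)]; linarith
  refine max_le (zero_le_one.trans h1) ?_
  rcases hy.eq_or_lt with h0 | hpos
  · subst h0
    exact Real.log_zero.le.trans (zero_le_one.trans h1)
  · exact Real.log_le_log hpos (le_add_of_nonneg_left (Real.exp_pos 1).le)

set_option maxHeartbeats 800000 in
/-- **`DGImpliesLogBudget` holds** (v7; was the M-sized prove target of v3–v6): (a‴) at
`(C₁, c₁)` gives (a) `PalinstrophyLogBudget C c` for every `c > 0` and every
`C ≥ C₁·(5/3 + ⅙log⁺(c₁⁶) + ⅔log⁺(c⁻¹))`. [ours; ingredients: tree theorems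
`torusPalinstrophy_hasDerivWithinAt`, `gradientAgmonBound_holds`,
`palinstrophyProductionSupBound_holds`, `torusVorticitySqAt_le_two_mul_sum_norm_sq`, `π > 3`] -/
theorem dgImpliesLogBudget_holds : DGImpliesLogBudget (d := d) := by
  intro C₁ c₁ hC₁ hc₁ hDG c hc
  obtain ⟨A₀, hA₀0, hA₀⟩ : ∃ A₀ : ℝ, 0 ≤ A₀ ∧
      A₀ = 6⁻¹ * max 0 (Real.log (c₁ ^ 6)) + 2 / 3 * max 0 (Real.log c⁻¹) :=
    ⟨_, add_nonneg (mul_nonneg (by norm_num) (le_max_left _ _))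
      (mul_nonneg (by norm_num) (le_max_left _ _)), rfl⟩
  refine ⟨C₁ * (5 / 3 + A₀), fun C hC => ?_⟩
  intro hd ν hν a b hab u p hsol t ht M hM hMx R hR
  have hνne : ν ≠ 0 := hν.ne'
  have hcne : c ≠ 0 := hc.ne'
  have hP0 : 0 ≤ torusPalinstrophy (u t) := torusPalinstrophy_nonneg _
  have hD0 : 0 ≤ palinstrophyDissipation (u t) := palinstrophyDissipation_nonneg _
  have hℓ1 : 1 ≤ Real.log (Real.exp 1 + c * torusPalinstrophy (u t) / ν ^ 2) := by
    rw [Real.le_log_iff_exp_le (by positivity)]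
    linarith [show 0 ≤ c * torusPalinstrophy (u t) / ν ^ 2 by positivity]
  have hℓ0 : 0 ≤ Real.log (Real.exp 1 + c * torusPalinstrophy (u t) / ν ^ 2) :=
    zero_le_one.trans hℓ1
  have hC0 : 0 ≤ C₁ * (5 / 3 + A₀) := by positivity
  have hMPℓ : 0 ≤ M * torusPalinstrophy (u t) *
      Real.log (Real.exp 1 + c * torusPalinstrophy (u t) / ν ^ 2) := by positivity
  -- it suffices to prove the bound with the constant `C₁ (5/3 + A₀)`
  suffices hmain : R ≤ C₁ * (5 / 3 + A₀) * (M * torusPalinstrophy (u t) *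
      Real.log (Real.exp 1 + c * torusPalinstrophy (u t) / ν ^ 2)) by
    calc R ≤ _ := hmain
      _ ≤ C * (M * torusPalinstrophy (u t) *
            Real.log (Real.exp 1 + c * torusPalinstrophy (u t) / ν ^ 2)) :=
          mul_le_mul_of_nonneg_right hC hMPℓ
      _ = C * M * torusPalinstrophy (u t) *
            Real.log (Real.exp 1 + c * torusPalinstrophy (u t) / ν ^ 2) := by ring
  rcases le_or_gt R 0 with hR0 | hRpos
  · exact hR0.trans (mul_nonneg hC0 hMPℓ)
  -- positive rate: the balance, Agmon, production
  have hder := torusPalinstrophy_hasDerivWithinAt hsol hab ht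
  have hU := uniqueDiffOn_Icc hab t ht
  have hRval : R = 2 * palinstrophyProduction (u t) - 2 * ν * palinstrophyDissipation (u t) :=
    (hR.derivWithin hU).symm.trans (hder.derivWithin hU)
  have hsm : Torus.IsSmooth (u t) := hsol.smooth_velocity.isSmooth_slice ht
  have hdf : Torus.IsDivFree (u t) := hsol.divFree t ht
  obtain ⟨q, hq0, hq2⟩ : ∃ q : ℝ, 0 ≤ q ∧ q ^ 2 = torusPalinstrophy (u t) :=
    ⟨Real.sqrt _, Real.sqrt_nonneg _, Real.sq_sqrt hP0⟩
  obtain ⟨s, hs0, hs2⟩ : ∃ s : ℝ, 0 ≤ s ∧ s ^ 2 = palinstrophyDissipation (u t) :=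
    ⟨Real.sqrt _, Real.sqrt_nonneg _, Real.sq_sqrt hD0⟩
  have hAg : ∀ x, ∑ i, ‖Torus.partialDeriv i (u t) x‖ ^ 2 ≤ 2 / Real.pi ^ 2 * q * s := by
    intro x
    have h := gradientAgmonBound_holds hd (u t) hsm x
    rw [← hq2, ← hs2, Real.sqrt_sq hq0, Real.sqrt_sq hs0] at h
    exact h
  obtain ⟨G, hG0, hGsq⟩ : ∃ G : ℝ, 0 ≤ G ∧ G ^ 2 = 2 / Real.pi ^ 2 * q * s :=
    ⟨Real.sqrt _, Real.sqrt_nonneg _, Real.sq_sqrt (by positivity)⟩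
  have hgrad : ∀ x, ∑ i, ‖Torus.partialDeriv i (u t) x‖ ^ 2 ≤ G ^ 2 := fun x => by
    rw [hGsq]; exact hAg x
  have hN : palinstrophyProduction (u t) ≤ 3 * G * torusPalinstrophy (u t) :=
    palinstrophyProductionSupBound_holds hd (u t) hsm hdf G hG0 hgrad
  rw [← hq2] at hN
  rw [← hs2] at hRval
  have hνD : ν * s ^ 2 < 3 * G * q ^ 2 := by linarith only [hRval, hRpos, hN]
  -- `ν² s³ ≤ 9 (2/π²) q⁵`
  have hsq : (ν * s ^ 2) ^ 2 ≤ (3 * G * q ^ 2) ^ 2 := pow_le_pow_left₀ (by positivity) hνD.le 2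
  have h3 : ν ^ 2 * s ^ 3 ≤ 9 * (2 / Real.pi ^ 2) * q ^ 5 := by
    have h4 : s * (ν ^ 2 * s ^ 3) ≤ s * (9 * (2 / Real.pi ^ 2) * q ^ 5) := by
      have e1 : (ν * s ^ 2) ^ 2 = s * (ν ^ 2 * s ^ 3) := by ring
      have e2 : (3 * G * q ^ 2) ^ 2 = s * (9 * (2 / Real.pi ^ 2) * q ^ 5) := by
        have : (3 * G * q ^ 2) ^ 2 = 9 * G ^ 2 * q ^ 4 := by ring
        rw [this, hGsq]; ring
      rw [← e1, ← e2]; exact hsq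
    rcases hs0.eq_or_lt with hs00 | hspos
    · subst hs00
      have : 0 ≤ 9 * (2 / Real.pi ^ 2) * q ^ 5 := by positivity
      simpa using this
    · exact le_of_mul_le_mul_left h4 hspos
  -- the admissible bound `M₁ = √2 G`: `M₁² = 2 (2/π²) q s`, `M₁⁶ ν² ≤ q⁸`
  obtain ⟨M₁, hM₁0, hM₁sq⟩ : ∃ M₁ : ℝ, 0 ≤ M₁ ∧ M₁ ^ 2 = 2 * (2 / Real.pi ^ 2 * q * s) :=
    ⟨Real.sqrt _, Real.sqrt_nonneg _, Real.sq_sqrt (by positivity)⟩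
  have hkey : M₁ ^ 6 * ν ^ 2 ≤ (q ^ 2) ^ 4 := by
    have e3 : M₁ ^ 6 = 8 * (2 / Real.pi ^ 2) ^ 3 * q ^ 3 * s ^ 3 := by
      have : M₁ ^ 6 = (M₁ ^ 2) ^ 3 := by ring
      rw [this, hM₁sq]; ring
    have ht0 : 0 ≤ 2 / Real.pi ^ 2 := by positivity
    have hπ : 2 / Real.pi ^ 2 ≤ 2 / 9 := by
      have h9 : (9 : ℝ) ≤ Real.pi ^ 2 := by nlinarith only [Real.pi_gt_three]
      exact div_le_div_of_nonneg_left (by norm_num) (by norm_num) h9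
    have hq8 : 0 ≤ q ^ 8 := by positivity
    have hpow := pow_le_pow_left₀ ht0 hπ 4
    calc M₁ ^ 6 * ν ^ 2 = 8 * (2 / Real.pi ^ 2) ^ 3 * q ^ 3 * (ν ^ 2 * s ^ 3) := by
          rw [e3]; ring
      _ ≤ 8 * (2 / Real.pi ^ 2) ^ 3 * q ^ 3 * (9 * (2 / Real.pi ^ 2) * q ^ 5) :=
          mul_le_mul_of_nonneg_left h3 (by positivity)
      _ = 72 * q ^ 8 * (2 / Real.pi ^ 2) ^ 4 := by ring
      _ ≤ 72 * q ^ 8 * (2 / 9) ^ 4 := mul_le_mul_of_nonneg_left hpow (by positivity)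
      _ ≤ (q ^ 2) ^ 4 := by linarith only [hq8]
  have hM₁x : ∀ x, torusVorticitySqAt (u t) x ≤ M₁ ^ 2 := fun x => by
    have h1 := torusVorticitySqAt_le_two_mul_sum_norm_sq (u t) x
    have h2 := hAg x
    rw [hM₁sq]; linarith only [h1, h2]
  -- (a‴) at the admissible bound `min M M₁`
  have hM'0 : 0 ≤ min M M₁ := le_min hM hM₁0
  have hM'x : ∀ x, torusVorticitySqAt (u t) x ≤ (min M M₁) ^ 2 := fun x => by
    rcases min_choice M M₁ with h | h <;> rw [h]
    · exact hMx x
    · exact hM₁x x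
  have hDG' := hDG hd hν hab hsol t ht (min M M₁) hM'0 hM'x R hR
  -- `log⁺` bookkeeping
  have hL1 : max 0 (Real.log (c₁ * min M M₁ / ν)) ≤ max 0 (Real.log (c₁ * M₁ / ν)) :=
    posLog_mono (by positivity)
      (div_le_div_of_nonneg_right (mul_le_mul_of_nonneg_left (min_le_right _ _) hc₁.le) hν.le)
  have hy6 : (c₁ * M₁ / ν) ^ 6 ≤ c₁ ^ 6 * (torusPalinstrophy (u t) / ν ^ 2) ^ 4 := by
    rw [← hq2]
    have hν8 : 0 < ν ^ 8 := by positivity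
    have e : (c₁ * M₁ / ν) ^ 6 = c₁ ^ 6 * (M₁ ^ 6 * ν ^ 2 / ν ^ 8) := by
      field_simp
    have e' : c₁ ^ 6 * (q ^ 2 / ν ^ 2) ^ 4 = c₁ ^ 6 * ((q ^ 2) ^ 4 / ν ^ 8) := by
      rw [div_pow]; ring
    rw [e, e']
    exact mul_le_mul_of_nonneg_left (div_le_div_of_nonneg_right hkey hν8.le) (by positivity)
  have hXlog : max 0 (Real.log (torusPalinstrophy (u t) / ν ^ 2)) ≤
      max 0 (Real.log c⁻¹) + Real.log (Real.exp 1 + c * torusPalinstrophy (u t) / ν ^ 2) := by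
    have e : torusPalinstrophy (u t) / ν ^ 2 = c⁻¹ * (c * torusPalinstrophy (u t) / ν ^ 2) := by
      rw [mul_div_assoc, ← mul_assoc, inv_mul_cancel₀ hcne, one_mul]
    calc max 0 (Real.log (torusPalinstrophy (u t) / ν ^ 2))
        = max 0 (Real.log (c⁻¹ * (c * torusPalinstrophy (u t) / ν ^ 2))) := by rw [← e]
      _ ≤ max 0 (Real.log c⁻¹) + max 0 (Real.log (c * torusPalinstrophy (u t) / ν ^ 2)) :=
          posLog_mul_le (by positivity) (by positivity)
      _ ≤ max 0 (Real.log c⁻¹) + Real.log (Real.exp 1 + c * torusPalinstrophy (u t) / ν ^ 2) := by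
          have := posLog_le_log_exp_one_add
            (show 0 ≤ c * torusPalinstrophy (u t) / ν ^ 2 by positivity)
          linarith only [this]
  have hlog6 : 6 * max 0 (Real.log (c₁ * M₁ / ν)) ≤ max 0 (Real.log (c₁ ^ 6)) +
      4 * (max 0 (Real.log c⁻¹) + Real.log (Real.exp 1 + c * torusPalinstrophy (u t) / ν ^ 2)) := by
    calc 6 * max 0 (Real.log (c₁ * M₁ / ν))
        = max 0 (Real.log ((c₁ * M₁ / ν) ^ 6)) := by rw [posLog_pow]; push_cast; ring
      _ ≤ max 0 (Real.log (c₁ ^ 6 * (torusPalinstrophy (u t) / ν ^ 2) ^ 4)) :=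
          posLog_mono (by positivity) hy6
      _ ≤ max 0 (Real.log (c₁ ^ 6)) + max 0 (Real.log ((torusPalinstrophy (u t) / ν ^ 2) ^ 4)) :=
          posLog_mul_le (by positivity) (by positivity)
      _ = max 0 (Real.log (c₁ ^ 6)) + 4 * max 0 (Real.log (torusPalinstrophy (u t) / ν ^ 2)) := by
          rw [posLog_pow _ 4]; push_cast; ring
      _ ≤ max 0 (Real.log (c₁ ^ 6)) + 4 * (max 0 (Real.log c⁻¹) +
            Real.log (Real.exp 1 + c * torusPalinstrophy (u t) / ν ^ 2)) := by linarith only [hXlog]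
  -- assembly of the inequalities
  have hL0 : 0 ≤ max 0 (Real.log (c₁ * min M M₁ / ν)) := le_max_left _ _
  have hL₁b : max 0 (Real.log (c₁ * M₁ / ν)) ≤
      A₀ + 2 / 3 * Real.log (Real.exp 1 + c * torusPalinstrophy (u t) / ν ^ 2) := by
    rw [hA₀]; linarith only [hlog6]
  have hνD0 : 0 ≤ ν * palinstrophyDissipation (u t) := mul_nonneg hν.le hD0
  rw [hs2] at hRval
  have step1 : R ≤ C₁ * min M M₁ * torusPalinstrophy (u t) *
      (1 + max 0 (Real.log (c₁ * min M M₁ / ν))) := by linarith only [hDG', hνD0]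
  have step2 : C₁ * min M M₁ * torusPalinstrophy (u t) *
      (1 + max 0 (Real.log (c₁ * min M M₁ / ν))) ≤
      C₁ * M * torusPalinstrophy (u t) * (1 + max 0 (Real.log (c₁ * min M M₁ / ν))) := by
    have h1L : 0 ≤ 1 + max 0 (Real.log (c₁ * min M M₁ / ν)) := by linarith only [hL0]
    have hmin : min M M₁ ≤ M := min_le_left _ _
    have := mul_le_mul_of_nonneg_right (mul_le_mul_of_nonneg_left hmin hC₁.le) hP0
    exact mul_le_mul_of_nonneg_right this h1L
  have step3 : C₁ * M * torusPalinstrophy (u t) * (1 + max 0 (Real.log (c₁ * min M M₁ / ν))) ≤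
      C₁ * (5 / 3 + A₀) * (M * torusPalinstrophy (u t) *
        Real.log (Real.exp 1 + c * torusPalinstrophy (u t) / ν ^ 2)) := by
    have hprod : 0 ≤ (1 + A₀) *
        (Real.log (Real.exp 1 + c * torusPalinstrophy (u t) / ν ^ 2) - 1) :=
      mul_nonneg (by linarith only [hA₀0]) (by linarith only [hℓ1])
    have h1 : 1 + max 0 (Real.log (c₁ * min M M₁ / ν)) ≤
        (5 / 3 + A₀) * Real.log (Real.exp 1 + c * torusPalinstrophy (u t) / ν ^ 2) := by
      linarith only [hL1, hL₁b, hℓ1, hprod]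
    have hCMP : 0 ≤ C₁ * M * torusPalinstrophy (u t) := by positivity
    calc C₁ * M * torusPalinstrophy (u t) * (1 + max 0 (Real.log (c₁ * min M M₁ / ν)))
        ≤ C₁ * M * torusPalinstrophy (u t) *
          ((5 / 3 + A₀) * Real.log (Real.exp 1 + c * torusPalinstrophy (u t) / ν ^ 2)) :=
          mul_le_mul_of_nonneg_left h1 hCMP
      _ = C₁ * (5 / 3 + A₀) * (M * torusPalinstrophy (u t) *
          Real.log (Real.exp 1 + c * torusPalinstrophy (u t) / ν ^ 2)) := by ring
  linarith only [step1, step2, step3]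

/-- **The large-`C` log door is a THEOREM on `T³`** (v7) [ours]: for every `c > 0` there is `C`
with `PalinstrophyLogBudget C c` at `d = Fin 3` — the positive half of the K1-Q3 threshold law
(negative half: `C < 2/π`, no-go seat, paper-level). Ingredients: the Literature fact p201667
(DG95 Thm 7.5 / BKM on the periodic box), `bkmImpliesDG_holds`, `dgImpliesLogBudget_holds`.
It is an a priori differential inequality driven by `‖ω‖_∞`, NOT a regularity statement.
Search for candidate a priori estimates; no regularity claim. -/
theorem palinstrophyLogBudgetLargeC_fin3_holds : PalinstrophyLogBudgetLargeC (d := Fin 3) :=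
  palinstrophyLogBudgetLargeC_fin3_of_DG dgImpliesLogBudget_holds

/-- Generic-dimension-type form: the BKM shape alone now implies the large-`C` door. [ours] -/
theorem palinstrophyLogBudgetLargeC_of_BKM' {c : ℝ} (hc : 0 < c)
    (hBKM : BKMLogGradientBound (d := d) c) : PalinstrophyLogBudgetLargeC (d := d) :=
  palinstrophyLogBudgetLargeC_of_BKM hc hBKM bkmImpliesDG_holds dgImpliesLogBudget_holds

end LargeC

end Summit.NavierStokesRegularity.FunctionalMining
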